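import Summits.Ventures.YMGap.RobustBall.RobustStarDoorVariance
import Summits.Ventures.YMGap.RobustBall.TorusRowsSU3StarW
import Summits.Ventures.YMGap.RobustBall.TorusDoorSUN
import HarnessLib

/-!
# Venture YMGap, track ROBUST-BALL (Y2) — crux Y2-X2 / Y2-X2-W, W12: EVERY-`N` SCHEMAS AND ROWS of the robust vertex-star door
# (variance form on the all-`N` Bakry–Émery pair), tiers 1 and 2, `d = 4` and `d = 3` — ONE certificate for ALL `N ≥ 2`

HONEST FRAMING. WHAT THIS IS: a venture file (cell `pub-ymgap`, track Y2 ROBUST-BALL, seat ds-2): numeric instances of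
`RobustStarDoorVariance` on the tree's hypothesis-free Bakry–Émery pair `(c_P, v) = (1/(N(1/2−b)), N/(1/2−b))`
(`oneLinkPoincareSUN_bakryEmery`, `oneLinkVarianceBound_bakryEmery`) at 't Hooft coupling `t = β⋆/N`, radius `b = 2(d−1)t < 1/2`:
robust coefficient `c ≥ e^{2ε} t/(1/2−b)` and off-column rows `λ ≥ e^{ε} ε s` with `s ≥ 1/√(2(1/2−b)) ≥ 1/√(N(1/2−b))` — both FREE OF `N`,
so every row below holds for EVERY `N ≥ 2` AT ONCE (hypothesis-free, class K; exact-rational certificates checked by `norm_num`).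
ROWS ('t Hooft `t`, one-parameter `ε`): `d = 4` TIER 1 (`TorusClusteringOnBallUpTo N 4 (N t) (2ε) ε r A m`, some `m > 0` depending on
`r` only): (1/64, .178) (1/48, .115) (1/40, .061) (1/36, .022) — the single-link every-`N` rows (`TorusRowsSUN`) are (1/64, .110) (1/96, .233)
with threshold `t < 1/48`; `d = 4` TIER 2 (`TorusClusteringOnBallW N 4 β κ (2ε) ε (8N e^{1/50}) (1/100)`, `0 ≤ β ≤ N t`, every
`κ ≥ 1/100`): (1/64, .175) (1/48, .113) (1/40, .059); `d = 3` (Y4's `ClusterDomainClustering` for every `SU(N)`): TIER 1 (1/40, .168)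
(1/32, .119) (1/24, .030) — single-link every-`N` (1/40, .087), threshold `1/32`; TIER 2 at rate `1/100`: (1/32, .117) (1/24, .029).
WHAT THIS IS NOT: in `SU(2)` Wilson units these cells sit at `β_W = 4t ≤ 1/9` (below the `SU(2)`-specific files); radii/rates are door
artefacts; torus currency; nothing about the continuum or the Millennium problem.

## References
* D. Bakry, M. Émery (1985); R. Holley, D. Stroock (1987); the tree: `RobustStarDoorVariance` (this seat), `TorusDoorSUN` (p1: the
  `N`-uniform single-link route, `one_div_sqrt_le`, `sqrt_bakryEmeryPair`), `StrongCouplingPoincareDoorSUN` / `StrongCouplingVarianceDoorSUN`.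
-/

noncomputable section

open Finset
open Literature.MathematicalPhysics.QuantumLattice (fundamentalRep)
open Literature.MathematicalPhysics.QuantumFieldTheory hiding ZdEdge
open Literature.MathematicalPhysics.QuantumFieldTheory.Balaban1983to89.StrongCouplingTorusWindow
open Summit.QuantumFields.BalabanUV.InfraRed.StrongCouplingPoincareDoorSUN (OneLinkPoincareSUN oneLinkPoincareSUN_bakryEmery)
open Summit.QuantumFields.BalabanUV.InfraRed.StrongCouplingVarianceDoorSUN (OneLinkVarianceBound oneLinkVarianceBound_bakryEmery)
open Summit.Ventures.YMGap.StarResolventDim (Delta gaugeR doorPoly Delta_pos_of_door gaugeR_lt_one_of_door)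
open Summit.Ventures.YMGap.RobustBallSUN (sqrt_bakryEmeryPair one_div_sqrt_le)

namespace Summit.Ventures.YMGap.RobustBall

variable {N : ℕ}

/-! ### The Bakry–Émery inputs at 't Hooft coupling `t` -/

/-- The two bounds the variance-form star door needs from the Bakry–Émery pair: `e^{ε₀}√(c_P v)·t ≤ E·t/(1/2−b)` and
`e^{ε₀/2}√c_P·ε₁ ≤ E₂ ε₁ s` (`N ≥ 2`, `b < 1/2`, `1 ≤ 2(1/2−b)s²`). [folklore] -/
theorem bakryEmery_star_inputs (hN : 2 ≤ N) {b ε₀ ε₁ E E₂ s : ℝ} (hb : b < 1 / 2) (hε₁ : 0 ≤ ε₁) (hE : Real.exp ε₀ ≤ E)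
    (hE₂ : Real.exp (ε₀ / 2) ≤ E₂) (hs : 0 ≤ s) (hqs : 1 ≤ 2 * (1 / 2 - b) * s ^ 2) (t : ℝ) (ht : 0 ≤ t) :
    Real.exp ε₀ * Real.sqrt (1 / ((N : ℝ) * (1 / 2 - b)) * ((N : ℝ) / (1 / 2 - b))) * t ≤ E * (t / (1 / 2 - b)) ∧
      Real.exp (ε₀ / 2) * Real.sqrt (1 / ((N : ℝ) * (1 / 2 - b))) * ε₁ ≤ E₂ * ε₁ * s := by
  have hN0 : (0 : ℝ) < N := by exact_mod_cast (show 0 < N by omega)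
  have hN2 : (2 : ℝ) ≤ N := by exact_mod_cast hN
  have hgap : 0 < 1 / 2 - b := by linarith
  obtain ⟨e1, e2⟩ := sqrt_bakryEmeryPair (N := N) hN0 hb
  rw [e1, e2]
  refine ⟨?_, ?_⟩
  · rw [show Real.exp ε₀ * (1 / (1 / 2 - b)) * t = Real.exp ε₀ * (t / (1 / 2 - b)) by ring]
    exact mul_le_mul_of_nonneg_right hE (by positivity)
  · have hsN : 1 / Real.sqrt ((N : ℝ) * (1 / 2 - b)) ≤ s := by
      refine le_trans (one_div_le_one_div_of_le (Real.sqrt_pos.2 (by positivity))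
        (Real.sqrt_le_sqrt (mul_le_mul_of_nonneg_right hN2 hgap.le))) ?_
      exact one_div_sqrt_le (by positivity) hs hqs
    have hE20 : 0 ≤ E₂ := (Real.exp_pos _).le.trans hE₂
    calc Real.exp (ε₀ / 2) * (1 / Real.sqrt ((N : ℝ) * (1 / 2 - b))) * ε₁
        = Real.exp (ε₀ / 2) * ε₁ * (1 / Real.sqrt ((N : ℝ) * (1 / 2 - b))) := by ring
      _ ≤ E₂ * ε₁ * s := mul_le_mul (mul_le_mul_of_nonneg_right hE₂ hε₁) hsN (by positivity) (mul_nonneg hE20 hε₁)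

/-! ### Schemas, `d = 4`, every `N ≥ 2` -/

/-- **SCHEMA, every `N ≥ 2`, `d = 4`, TIER 1** ('t Hooft ceiling `t`, `6t < 1/2`): the rational certificate
`doorPoly 4 c < 1 ∧ 6c + λ < 1 ∧ gaugeR 4 c + (λ + (6c+λ)^K·16λ)/(1−(6c+λ)) < 1` with `c ≥ E t/(1/2−6t)`, `λ ≥ E₂ ε₁ s`
(`E ≥ e^{ε₀}`, `E₂ ≥ e^{ε₀/2}`, `1 ≤ 2(1/2−6t)s²`) gives `TorusClusteringOnBallUpTo N 4 (N t) ε₀ ε₁ r A m` with `m > 0` depending on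
`r` (and the certificate) only — for EVERY `N ≥ 2`. [folklore] -/
theorem suN_torusClusteringOnBallUpTo_star_bakryEmery (Kn : ℕ) (hN : 2 ≤ N) {t ε₀ ε₁ c lam E E₂ s : ℝ} (ht0 : 0 ≤ t)
    (ht : 6 * t < 1 / 2) (hε₁ : 0 ≤ ε₁) (hE : Real.exp ε₀ ≤ E) (hE₂ : Real.exp (ε₀ / 2) ≤ E₂) (hs : 0 ≤ s)
    (hqs : 1 ≤ 2 * (1 / 2 - 6 * t) * s ^ 2) (hc : E * (t / (1 / 2 - 6 * t)) ≤ c) (hlam : E₂ * ε₁ * s ≤ lam)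
    (hθ1 : 6 * c + lam < 1) (hcd : doorPoly 4 c < 1)
    (hρ1 : gaugeR 4 c + (lam + (6 * c + lam) ^ Kn * (16 * lam)) / (1 - (6 * c + lam)) < 1) (r : ℕ) :
    ∃ A m : ℝ, 0 < m ∧ TorusClusteringOnBallUpTo N 4 ((N : ℝ) * t) ε₀ ε₁ r A m := by
  have hN1 : 1 ≤ N := by omega
  have hN0 : (0 : ℝ) < N := by exact_mod_cast (show 0 < N by omega)
  have hb : (6 : ℝ) * t < 1 / 2 := ht
  have hgap : 0 < 1 / 2 - 6 * t := by linarith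
  have hP := oneLinkPoincareSUN_bakryEmery hN hb
  have hV := oneLinkVarianceBound_bakryEmery hN hb
  obtain ⟨h1, h2⟩ := bakryEmery_star_inputs hN hb hε₁ hE hE₂ hs hqs t ht0
  have hc0 : 0 ≤ c := le_trans (le_trans (by positivity) h1) hc
  have hE0 : 0 ≤ E₂ := (Real.exp_pos _).le.trans hE₂
  have hlam0 : 0 ≤ lam := le_trans (by positivity) hlam
  set θ : ℝ := 6 * c + lam with hθ
  set ρ : ℝ := gaugeR 4 c + (lam + θ ^ Kn * (16 * lam)) / (1 - θ) with hρ
  have hθ0 : 0 ≤ θ := by positivity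
  have hgR := gaugeR_lt_one_of_door (d := 4) (by norm_num) hc0 hcd
  have hρ0 : 0 ≤ ρ := by
    have : 0 ≤ θ ^ Kn := pow_nonneg hθ0 Kn
    have h1' : 0 < 1 - θ := by linarith
    rw [hρ]; exact add_nonneg hgR.1 (div_nonneg (by positivity) h1'.le)
  have htN : (N : ℝ) * t / N = t := by field_simp
  have hb' : (N : ℝ) * t / N * (2 * (((4 : ℕ) : ℝ) - 1)) ≤ 6 * t := by rw [htN]; norm_num; linarith
  have hc' : Real.exp ε₀ * Real.sqrt (1 / ((N : ℝ) * (1 / 2 - 6 * t)) * ((N : ℝ) / (1 / 2 - 6 * t))) * ((N : ℝ) * t / N) ≤ c := by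
    rw [htN]; exact h1.trans hc
  have hθ' : θ = (2 * ((4 : ℕ) : ℝ) - 2) * c + lam := by rw [hθ]; push_cast; ring
  have hρ' : ρ = gaugeR 4 c + (lam + θ ^ Kn * (4 * ((4 : ℕ) : ℝ) * lam)) / (1 - θ) := by rw [hρ]; push_cast; ring
  have h := torusClusteringOnBallUpTo_of_robustStar_variance (d := 4) (N := N) (by norm_num) hN1 r Kn (by positivity)
    (by positivity) hb' hP hV hε₁ hc' (h2.trans hlam) hθ' hθ1 hcd hρ' hρ1
  refine ⟨_, _, ?_, h⟩
  have h1' : 0 < 1 - ρ := by linarith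
  have hden : 0 < 2 * (2 * ρ * ((2 * 4 : ℕ) : ℝ) + 1) := by push_cast; nlinarith
  positivity

/-- **SCHEMA, every `N ≥ 2`, `d = 4`, TIER 2** (weighted ball `ClusterDomain κ ε₀ ε₁`, rate `t' ≤ κ`, `T₁ ≥ e^{t'}`, `T₂ ≥ e^{2t'}`):
`TorusClusteringOnBallW N 4 β κ ε₀ ε₁ (8N e^{2t'}) t'` for every `0 ≤ β ≤ N t` and EVERY `N ≥ 2`. [folklore] -/
theorem suN_torusClusteringOnBallW_star_bakryEmery (Kn : ℕ) (hN : 2 ≤ N) {t κ ε₀ ε₁ c lam E E₂ s t' T₁ T₂ : ℝ} (ht0 : 0 ≤ t)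
    (ht : 6 * t < 1 / 2) (hε₁ : 0 ≤ ε₁) (ht'0 : 0 ≤ t') (ht'κ : t' ≤ κ) (hE : Real.exp ε₀ ≤ E) (hE₂ : Real.exp (ε₀ / 2) ≤ E₂)
    (hs : 0 ≤ s) (hqs : 1 ≤ 2 * (1 / 2 - 6 * t) * s ^ 2) (hT₁ : Real.exp t' ≤ T₁) (hT₂ : Real.exp (2 * t') ≤ T₂)
    (hc : E * (t / (1 / 2 - 6 * t)) ≤ c) (hlam : E₂ * ε₁ * s ≤ lam) (hθ1 : 6 * c + lam < 1) (hcd : doorPoly 4 c < 1)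
    (hρ1 : T₁ * (gaugeR 4 c + (T₂ * lam + (6 * c + lam) ^ Kn * (16 * (T₂ * lam))) / (1 - (6 * c + lam))) < 1) :
    ∀ β : ℝ, 0 ≤ β → β ≤ (N : ℝ) * t → TorusClusteringOnBallW N 4 β κ ε₀ ε₁ (8 * N * Real.exp (2 * t')) t' := by
  have hN1 : 1 ≤ N := by omega
  have hN0 : (0 : ℝ) < N := by exact_mod_cast (show 0 < N by omega)
  have hb : (6 : ℝ) * t < 1 / 2 := ht
  have hgap : 0 < 1 / 2 - 6 * t := by linarith
  have hP := oneLinkPoincareSUN_bakryEmery hN hb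
  have hV := oneLinkVarianceBound_bakryEmery hN hb
  obtain ⟨h1, h2⟩ := bakryEmery_star_inputs hN hb hε₁ hE hE₂ hs hqs t ht0
  have hc0 : 0 ≤ c := le_trans (le_trans (by positivity) h1) hc
  have hE0 : 0 ≤ E₂ := (Real.exp_pos _).le.trans hE₂
  have hlam0 : 0 ≤ lam := le_trans (by positivity) hlam
  set θ : ℝ := 6 * c + lam with hθ
  set ρ : ℝ := Real.exp t' * (gaugeR 4 c +
    (Real.exp (2 * t') * lam + θ ^ Kn * (16 * (Real.exp (2 * t') * lam))) / (1 - θ)) with hρ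
  have hθ0 : 0 ≤ θ := by positivity
  have h1θ : 0 < 1 - θ := by linarith
  have hgR := gaugeR_lt_one_of_door (d := 4) (by norm_num) hc0 hcd
  have hθK : 0 ≤ θ ^ Kn := pow_nonneg hθ0 Kn
  have hin0 : 0 ≤ gaugeR 4 c + (Real.exp (2 * t') * lam + θ ^ Kn * (16 * (Real.exp (2 * t') * lam))) / (1 - θ) :=
    add_nonneg hgR.1 (div_nonneg (by positivity) h1θ.le)
  have hin : gaugeR 4 c + (Real.exp (2 * t') * lam + θ ^ Kn * (16 * (Real.exp (2 * t') * lam))) / (1 - θ) ≤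
      gaugeR 4 c + (T₂ * lam + θ ^ Kn * (16 * (T₂ * lam))) / (1 - θ) := by
    have h1' : Real.exp (2 * t') * lam ≤ T₂ * lam := mul_le_mul_of_nonneg_right hT₂ hlam0
    have h2' : θ ^ Kn * (16 * (Real.exp (2 * t') * lam)) ≤ θ ^ Kn * (16 * (T₂ * lam)) :=
      mul_le_mul_of_nonneg_left (by linarith) hθK
    exact add_le_add le_rfl (div_le_div_of_nonneg_right (add_le_add h1' h2') h1θ.le)
  have hρ1' : ρ < 1 :=
    calc ρ ≤ T₁ * (gaugeR 4 c + (T₂ * lam + θ ^ Kn * (16 * (T₂ * lam))) / (1 - θ)) :=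
          mul_le_mul hT₁ hin hin0 ((Real.exp_pos _).le.trans hT₁)
      _ < 1 := hρ1
  have htN : (N : ℝ) * t / N = t := by field_simp
  have hb' : (N : ℝ) * t / N * (2 * (((4 : ℕ) : ℝ) - 1)) ≤ 6 * t := by rw [htN]; norm_num; linarith
  have hc' : Real.exp ε₀ * Real.sqrt (1 / ((N : ℝ) * (1 / 2 - 6 * t)) * ((N : ℝ) / (1 / 2 - 6 * t))) * ((N : ℝ) * t / N) ≤ c := by
    rw [htN]; exact h1.trans hc
  have hθ' : θ = (2 * ((4 : ℕ) : ℝ) - 2) * c + lam := by rw [hθ]; push_cast; ring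
  have hρ' : ρ = Real.exp t' * (gaugeR 4 c +
      (Real.exp (2 * t') * lam + θ ^ Kn * (4 * ((4 : ℕ) : ℝ) * (Real.exp (2 * t') * lam))) / (1 - θ)) := by
    rw [hρ]; push_cast; ring
  have h := torusClusteringOnBallW_upTo_of_robustStar_variance (d := 4) (N := N) (by norm_num) hN1 Kn (by positivity)
    (by positivity) hb' hP hV hε₁ ht'0 ht'κ hc' (h2.trans hlam) hθ' hθ1 hcd hρ' hρ1'
  rw [two_mul_sq_two_sqrt_nat] at h
  exact h

/-! ### Schemas, `d = 3`, every `N ≥ 2` (Y4's receiving currency for every `SU(N)`) -/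

/-- **SCHEMA, every `N ≥ 2`, `d = 3`, TIER 1** ('t Hooft ceiling `t`, `4t < 1/2`; door `8c² + 6c < 1`, `θ = 4c + λ`):
`ClusterDomainClustering` on `ClusterDomainFR ε₀ ε₁ r` up to `N t`, plus the torus form. [folklore] -/
theorem suN_clusterDomainClustering_dim3_star_bakryEmery (Kn : ℕ) (hN : 2 ≤ N) {t ε₀ ε₁ c lam E E₂ s : ℝ} (ht0 : 0 ≤ t)
    (ht : 4 * t < 1 / 2) (hε₁ : 0 ≤ ε₁) (hE : Real.exp ε₀ ≤ E) (hE₂ : Real.exp (ε₀ / 2) ≤ E₂) (hs : 0 ≤ s)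
    (hqs : 1 ≤ 2 * (1 / 2 - 4 * t) * s ^ 2) (hc : E * (t / (1 / 2 - 4 * t)) ≤ c) (hlam : E₂ * ε₁ * s ≤ lam)
    (hθ1 : 4 * c + lam < 1) (hcd : doorPoly 3 c < 1)
    (hρ1 : gaugeR 3 c + (lam + (4 * c + lam) ^ Kn * (12 * lam)) / (1 - (4 * c + lam)) < 1) (r : ℕ) :
    ∃ m : ℝ, 0 < m ∧
      YM3IR.ClusterDomainClustering (G := SUN N)
        ⟨fundamentalRep (Fin N), (N : ℝ) * t, fun _ _ W => W ∈ ClusterDomainFR ε₀ ε₁ r⟩ suFrobDist m ∧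
      ∃ A : ℝ, TorusClusteringOnBallUpTo N 3 ((N : ℝ) * t) ε₀ ε₁ r A m := by
  have hN1 : 1 ≤ N := by omega
  have hN0 : (0 : ℝ) < N := by exact_mod_cast (show 0 < N by omega)
  have hb : (4 : ℝ) * t < 1 / 2 := ht
  have hgap : 0 < 1 / 2 - 4 * t := by linarith
  have hP := oneLinkPoincareSUN_bakryEmery hN hb
  have hV := oneLinkVarianceBound_bakryEmery hN hb
  obtain ⟨h1, h2⟩ := bakryEmery_star_inputs hN hb hε₁ hE hE₂ hs hqs t ht0
  have hc0 : 0 ≤ c := le_trans (le_trans (by positivity) h1) hc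
  have hE0 : 0 ≤ E₂ := (Real.exp_pos _).le.trans hE₂
  have hlam0 : 0 ≤ lam := le_trans (by positivity) hlam
  set θ : ℝ := 4 * c + lam with hθ
  set ρ : ℝ := gaugeR 3 c + (lam + θ ^ Kn * (12 * lam)) / (1 - θ) with hρ
  have hθ0 : 0 ≤ θ := by positivity
  have hgR := gaugeR_lt_one_of_door (d := 3) (by norm_num) hc0 hcd
  have hρ0 : 0 ≤ ρ := by
    have : 0 ≤ θ ^ Kn := pow_nonneg hθ0 Kn
    have h1' : 0 < 1 - θ := by linarith
    rw [hρ]; exact add_nonneg hgR.1 (div_nonneg (by positivity) h1'.le)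
  have htN : (N : ℝ) * t / N = t := by field_simp
  have hb' : (N : ℝ) * t / N * 4 ≤ 4 * t := by rw [htN]; linarith
  have hb'' : (N : ℝ) * t / N * (2 * (((3 : ℕ) : ℝ) - 1)) ≤ 4 * t := by rw [htN]; norm_num; linarith
  have hc' : Real.exp ε₀ * Real.sqrt (1 / ((N : ℝ) * (1 / 2 - 4 * t)) * ((N : ℝ) / (1 / 2 - 4 * t))) * ((N : ℝ) * t / N) ≤ c := by
    rw [htN]; exact h1.trans hc
  have hθ' : θ = (2 * ((3 : ℕ) : ℝ) - 2) * c + lam := by rw [hθ]; push_cast; ring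
  have hρ' : ρ = gaugeR 3 c + (lam + θ ^ Kn * (4 * ((3 : ℕ) : ℝ) * lam)) / (1 - θ) := by rw [hρ]; push_cast; ring
  have hm : 0 < (1 - ρ) ^ 2 / (2 * (2 * ρ * ((2 * 3 : ℕ) : ℝ) + 1)) / ((max r 1 + 2 : ℕ) : ℝ) := by
    have h1' : 0 < 1 - ρ := by linarith
    have hden : 0 < 2 * (2 * ρ * ((2 * 3 : ℕ) : ℝ) + 1) := by push_cast; nlinarith
    positivity
  refine ⟨_, hm, clusterDomainClustering_dim3_of_robustStar_variance (N := N) hN1 r Kn (by positivity) (by positivity) hb' hP hV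
    hε₁ hc' (h2.trans hlam) hθ hθ1 hcd hρ hρ1, _,
    torusClusteringOnBallUpTo_of_robustStar_variance (d := 3) (N := N) (by norm_num) hN1 r Kn (by positivity) (by positivity) hb''
      hP hV hε₁ hc' (h2.trans hlam) hθ' hθ1 hcd hρ' hρ1⟩

/-- **SCHEMA, every `N ≥ 2`, `d = 3`, TIER 2**: `ClusterDomainClustering` on the weighted ball `ClusterDomain κ ε₀ ε₁` up to `N t` at
rate `t' ≤ κ`, plus the torus form. [folklore] -/
theorem suN_clusterDomainClusteringW_dim3_star_bakryEmery (Kn : ℕ) (hN : 2 ≤ N) {t κ ε₀ ε₁ c lam E E₂ s t' T₁ T₂ : ℝ}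
    (ht0 : 0 ≤ t) (ht : 4 * t < 1 / 2) (hε₁ : 0 ≤ ε₁) (ht'0 : 0 ≤ t') (ht'κ : t' ≤ κ) (hE : Real.exp ε₀ ≤ E)
    (hE₂ : Real.exp (ε₀ / 2) ≤ E₂) (hs : 0 ≤ s) (hqs : 1 ≤ 2 * (1 / 2 - 4 * t) * s ^ 2) (hT₁ : Real.exp t' ≤ T₁)
    (hT₂ : Real.exp (2 * t') ≤ T₂) (hc : E * (t / (1 / 2 - 4 * t)) ≤ c) (hlam : E₂ * ε₁ * s ≤ lam) (hθ1 : 4 * c + lam < 1)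
    (hcd : doorPoly 3 c < 1)
    (hρ1 : T₁ * (gaugeR 3 c + (T₂ * lam + (4 * c + lam) ^ Kn * (12 * (T₂ * lam))) / (1 - (4 * c + lam))) < 1) :
    YM3IR.ClusterDomainClustering (G := SUN N)
        ⟨fundamentalRep (Fin N), (N : ℝ) * t, fun _ _ W => W ∈ ClusterDomain κ ε₀ ε₁⟩ suFrobDist t' ∧
      ∀ β : ℝ, 0 ≤ β → β ≤ (N : ℝ) * t → TorusClusteringOnBallW N 3 β κ ε₀ ε₁ (8 * N * Real.exp (2 * t')) t' := by
  have hN1 : 1 ≤ N := by omega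
  have hN0 : (0 : ℝ) < N := by exact_mod_cast (show 0 < N by omega)
  have hb : (4 : ℝ) * t < 1 / 2 := ht
  have hgap : 0 < 1 / 2 - 4 * t := by linarith
  have hP := oneLinkPoincareSUN_bakryEmery hN hb
  have hV := oneLinkVarianceBound_bakryEmery hN hb
  obtain ⟨h1, h2⟩ := bakryEmery_star_inputs hN hb hε₁ hE hE₂ hs hqs t ht0
  have hc0 : 0 ≤ c := le_trans (le_trans (by positivity) h1) hc
  have hE0 : 0 ≤ E₂ := (Real.exp_pos _).le.trans hE₂
  have hlam0 : 0 ≤ lam := le_trans (by positivity) hlam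
  set θ : ℝ := 4 * c + lam with hθ
  set ρ : ℝ := Real.exp t' * (gaugeR 3 c +
    (Real.exp (2 * t') * lam + θ ^ Kn * (12 * (Real.exp (2 * t') * lam))) / (1 - θ)) with hρ
  have hθ0 : 0 ≤ θ := by positivity
  have h1θ : 0 < 1 - θ := by linarith
  have hgR := gaugeR_lt_one_of_door (d := 3) (by norm_num) hc0 hcd
  have hθK : 0 ≤ θ ^ Kn := pow_nonneg hθ0 Kn
  have hin0 : 0 ≤ gaugeR 3 c + (Real.exp (2 * t') * lam + θ ^ Kn * (12 * (Real.exp (2 * t') * lam))) / (1 - θ) :=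
    add_nonneg hgR.1 (div_nonneg (by positivity) h1θ.le)
  have hin : gaugeR 3 c + (Real.exp (2 * t') * lam + θ ^ Kn * (12 * (Real.exp (2 * t') * lam))) / (1 - θ) ≤
      gaugeR 3 c + (T₂ * lam + θ ^ Kn * (12 * (T₂ * lam))) / (1 - θ) := by
    have h1' : Real.exp (2 * t') * lam ≤ T₂ * lam := mul_le_mul_of_nonneg_right hT₂ hlam0
    have h2' : θ ^ Kn * (12 * (Real.exp (2 * t') * lam)) ≤ θ ^ Kn * (12 * (T₂ * lam)) :=
      mul_le_mul_of_nonneg_left (by linarith) hθK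
    exact add_le_add le_rfl (div_le_div_of_nonneg_right (add_le_add h1' h2') h1θ.le)
  have hρ1' : ρ < 1 :=
    calc ρ ≤ T₁ * (gaugeR 3 c + (T₂ * lam + θ ^ Kn * (12 * (T₂ * lam))) / (1 - θ)) :=
          mul_le_mul hT₁ hin hin0 ((Real.exp_pos _).le.trans hT₁)
      _ < 1 := hρ1
  have htN : (N : ℝ) * t / N = t := by field_simp
  have hb' : (N : ℝ) * t / N * 4 ≤ 4 * t := by rw [htN]; linarith
  have hb'' : (N : ℝ) * t / N * (2 * (((3 : ℕ) : ℝ) - 1)) ≤ 4 * t := by rw [htN]; norm_num; linarith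
  have hc' : Real.exp ε₀ * Real.sqrt (1 / ((N : ℝ) * (1 / 2 - 4 * t)) * ((N : ℝ) / (1 / 2 - 4 * t))) * ((N : ℝ) * t / N) ≤ c := by
    rw [htN]; exact h1.trans hc
  have hθ' : θ = (2 * ((3 : ℕ) : ℝ) - 2) * c + lam := by rw [hθ]; push_cast; ring
  have hρ' : ρ = Real.exp t' * (gaugeR 3 c +
      (Real.exp (2 * t') * lam + θ ^ Kn * (4 * ((3 : ℕ) : ℝ) * (Real.exp (2 * t') * lam))) / (1 - θ)) := by
    rw [hρ]; push_cast; ring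
  refine ⟨clusterDomainClusteringW_dim3_of_robustStar_variance (N := N) hN1 Kn (by positivity) (by positivity) hb' hP hV hε₁
    ht'0 ht'κ hc' (h2.trans hlam) hθ hθ1 hcd hρ hρ1', ?_⟩
  have h := torusClusteringOnBallW_upTo_of_robustStar_variance (d := 3) (N := N) (by norm_num) hN1 Kn (by positivity)
    (by positivity) hb'' hP hV hε₁ ht'0 ht'κ hc' (h2.trans hlam) hθ' hθ1 hcd hρ' hρ1'
  rw [two_mul_sq_two_sqrt_nat] at h
  exact h

end Summit.Ventures.YMGap.RobustBall

end
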